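import Summits.Ventures.QEC.Theorems.BB72DistanceCertificateTarget
import Summits.Ventures.QEC.Census.BB.Claims
import Literature.InformationTheory.QuantumCodes.CSSFiniteSizeBounds
import HarnessLib

/-!
# Certified LOSS-AND-ERROR bounds for the bivariate-bicycle codes `[[72,12,6]]` (unconditional) and
# `[[144,12,12]]` (given its claim): `P_fail ≤ n (5Υ)^d / (5(1-5Υ))`, `Υ = y + 2(1-y)√(p(1-p))`

Venture QEC, `Summits/Ventures/QEC/Thresholds/` (companion of `BBFiniteSizeBounds.lean`, split off for the
400-line limit; qec-lit-2 gen 3). HONEST FRAMING as there: one error type (`Z`-errors detected by `H^X`), the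
decoder knows the lost qubits `Er` (rate `y`) and minimises the number of NON-lost error positions
(`ErasureDecoder.IsMinWeightOutside`, DKP15's maximum-likelihood decoder for the mixed channel), errors of rate
`p ≤ 1/2` on the other qubits; `mixedFailureProb` is robust in the (arbitrary) errors on lost qubits. Tiers:
`[[72,12,6]]` rows UNCONDITIONAL kernel (`bb72_d`); `[[144,12,12]]` rows take `BB144_12_12_claim` as hypothesis.
The two axes `y = 0` / `p = 0` reproduce the code-capacity and erasure rows of `BBFiniteSizeBounds.lean`.

## References

* [DumerKovalevPryadko2015] I. Dumer, A. A. Kovalev, L. P. Pryadko, PRL 115 (2015) 050502, Thm 2, App. A §1.1.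
* [BravyiEtAl2024] S. Bravyi et al., Nature 627 (2024) 778, Table 1.
-/

noncomputable section

namespace Summit.Ventures.QEC.Thresholds

open Finset Matrix
open Literature.InformationTheory.QuantumCodes
open Summit.Ventures.QEC.BB Summit.Ventures.QEC.Census.BB72

/-! ### Losses and errors simultaneously -/

/-- **`[[72,12,6]]`, LOSSES AND ERRORS** (loss rate `y`, error rate `p`, every minimum-weight-outside-the-losses
decoder): `P_fail ≤ 72 (5Υ)⁶ / (5 (1 - 5Υ))`, `Υ = y + 2(1-y)√(p(1-p))`, `5Υ < 1`. UNCONDITIONAL, kernel.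
[cite: DumerKovalevPryadko2015, Thm 2 (w = 6) with App. A §1.1] -/
theorem bb72_zMixedFailureProb_le {D : ErasureDecoder (BB.Mono 6 6 ⊕ BB.Mono 6 6) (BB.Mono 6 6 → ZMod 2)}
    (hD : D.IsMinWeightOutside BB.bb72.HX)
    {y p : ℝ} (hy0 : 0 ≤ y) (hy1 : y ≤ 1) (hp0 : 0 ≤ p) (hp : p ≤ 1 / 2) (hr : 5 * upsilonCSS y p < 1) :
    mixedFailureProb BB.bb72.HX (BB.bb72.css.rowSpZ : Set (BB.Mono 6 6 ⊕ BB.Mono 6 6 → ZMod 2)) D y p ≤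
      72 * (5 * upsilonCSS y p) ^ 6 / (5 * (1 - 5 * upsilonCSS y p)) := by
  have h := BB.zMixedFailureProb_le BB.bb72 BB.isBBPoly_bb72.1 BB.isBBPoly_bb72.2 hD (by rw [bb72_d]; norm_num)
    hy0 hy1 hp0 hp hr
  rw [bb72_d] at h
  convert h using 2
  norm_num

/-- **`[[144,12,12]]`, LOSSES AND ERRORS**, GIVEN the claim: `P_fail ≤ 144 (5Υ)¹² / (5 (1 - 5Υ))`.
[cite: DumerKovalevPryadko2015, Thm 2 (w = 6) with App. A §1.1] -/
theorem bb144_zMixedFailureProb_le (h : BB144_12_12_claim)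
    {D : ErasureDecoder (BB.Mono 12 6 ⊕ BB.Mono 12 6) (BB.Mono 12 6 → ZMod 2)}
    (hD : D.IsMinWeightOutside BB.bb144.HX)
    {y p : ℝ} (hy0 : 0 ≤ y) (hy1 : y ≤ 1) (hp0 : 0 ≤ p) (hp : p ≤ 1 / 2) (hr : 5 * upsilonCSS y p < 1) :
    mixedFailureProb BB.bb144.HX (BB.bb144.css.rowSpZ : Set (BB.Mono 12 6 ⊕ BB.Mono 12 6 → ZMod 2)) D y p ≤
      144 * (5 * upsilonCSS y p) ^ 12 / (5 * (1 - 5 * upsilonCSS y p)) := by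
  have hd : BB.bb144.d = 12 := h.2.2
  have h' := BB.zMixedFailureProb_le BB.bb144 BB.isBBPoly_bb144.1 BB.isBBPoly_bb144.2 hD
    (by rw [hd]; norm_num) hy0 hy1 hp0 hp hr
  rw [hd] at h'
  convert h' using 2
  norm_num

/-- **Losses and errors, generic census interface**: `≤ n (5Υ)^d / (5(1-5Υ))` for every BB census row.
[cite: DumerKovalevPryadko2015, Thm 2 (w = 6) with App. A §1.1] -/
theorem bb_zMixedFailureProb_le_of_hasParams {ℓ m : ℕ} [NeZero ℓ] [NeZero m] (C : BB.Code ℓ m)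
    (hA : BB.IsBBPoly C.A) (hB : BB.IsBBPoly C.B) {n k d : ℕ} (h : HasParams C n k d) (hd1 : 1 ≤ d)
    {D : ErasureDecoder (BB.Mono ℓ m ⊕ BB.Mono ℓ m) (BB.Mono ℓ m → ZMod 2)} (hD : D.IsMinWeightOutside C.HX)
    {y p : ℝ} (hy0 : 0 ≤ y) (hy1 : y ≤ 1) (hp0 : 0 ≤ p) (hp : p ≤ 1 / 2) (hr : 5 * upsilonCSS y p < 1) :
    mixedFailureProb C.HX (C.css.rowSpZ : Set (BB.Mono ℓ m ⊕ BB.Mono ℓ m → ZMod 2)) D y p ≤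
      (n : ℝ) * (5 * upsilonCSS y p) ^ d / (5 * (1 - 5 * upsilonCSS y p)) := by
  obtain ⟨hn, -, hd⟩ := h
  have h' := BB.zMixedFailureProb_le C hA hB hD (by rw [hd]; exact hd1) hy0 hy1 hp0 hp hr
  rw [hd] at h'
  rw [← hn, BB.numQubits_eq]
  exact h'

/-- Non-vacuity of the loss-aware decoder class on every BB code. [cite: DumerKovalevPryadko2015, p. 3 (exhaustive search decoder)] -/
theorem bb_minWeightOutside_isMinWeightOutside {ℓ m : ℕ} [NeZero ℓ] [NeZero m] (C : BB.Code ℓ m) :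
    (ErasureDecoder.minWeightOutside C.HX).IsMinWeightOutside C.HX :=
  ErasureDecoder.minWeightOutside_isMinWeightOutside C.HX

end Summit.Ventures.QEC.Thresholds
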